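import Summits.CriticalPhenomena.PercolationContinuityZ3.Theorems.PercNearOneGluingNoHeavyLowerTailTwoDownsetMatching

/-!
# Shared Kleitman–Hall on a single cube, `Finset` form (support file, crux `stmt-CriticalPhenomena-4575`, lineage prim-bnk-2 g28)

Support file (`--supports stmt-CriticalPhenomena-4575`; memo `run/shared/lean/prim/prim-l12/FROM-prim-bnk-2-g28-SHARED-KH-PROVED.md` §1).
No definitions, no `sorry`, standard axioms.  The cube-level corollary (C2) of THEOREM T (`SahiFComb.Shift.exists_disjoint_equiv_of_union`,
companion file `…TwoDownsetMatching`), in the `Finset (Finset α)` language of the `SahiFComb.Shift` toolkit (complement `xᶜ = univ \\ x`):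
for up-closed families `B, C, U` of subsets of a finite type,
  `#{x∈U : x∈C∖B, xᶜ∈B} + #{x∈U : x∈B∖C, xᶜ∈B∩C} ≤ #{x∈U : x∈B∩C, xᶜ∉B∩C}`
(`sharedKleitmanHall_card`), via an explicit upward injection (`exists_sharedKleitmanHall_injection`).  Kleitman's lemma
`#{x∈U : x∉G, xᶜ∈G} ≤ #{x∈U : x∈G, xᶜ∉G}` is the case `B = univ` (`C = G`) or `C = univ` (`B = G`).  The twisted three-partition version
(the tree's `ThreePartition.ColumnSharedKleitmanHall`) is assembled separately in `…ThreePartitionColumnSharedKH`. [this work]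
-/

namespace Summit.CriticalPhenomena.PercolationContinuityZ3.Theorems

namespace SahiFComb.Shift

open Finset

variable {α : Type*} [Fintype α] [DecidableEq α]

/-- **Shared Kleitman–Hall, injection form** (memo §1, COROLLARY (C2)).  For up-closed `B, C`: with `E = (B ∖ σB) ∪ (B∩C)`, `L = σE ∖ E`,
THEOREM T applied to the down-sets `L ∖ B` and `L ∩ σC` gives a map `φ` on the sources `S = {x∈C∖B : xᶜ∈B} ∪ {x∈B∖C : xᶜ∈B∩C}` with
`x ⊆ φ x`, `φ x ∈ B∩C`, `(φ x)ᶜ ∉ B∩C`, injective on `S`. [this work] -/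
theorem exists_sharedKleitmanHall_injection [LinearOrder α] (B C : Finset (Finset α))
    (hB : ∀ K ∈ B, ∀ K', K ⊆ K' → K' ∈ B) (hC : ∀ K ∈ C, ∀ K', K ⊆ K' → K' ∈ C) :
    ∃ φ : Finset α → Finset α, ∀ x : Finset α,
      ((x ∈ C ∧ x ∉ B ∧ xᶜ ∈ B) ∨ (x ∈ B ∧ x ∉ C ∧ xᶜ ∈ B ∧ xᶜ ∈ C)) →
        x ⊆ φ x ∧ φ x ∈ B ∧ φ x ∈ C ∧ ¬ ((φ x)ᶜ ∈ B ∧ (φ x)ᶜ ∈ C) ∧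
        ∀ x' : Finset α, ((x' ∈ C ∧ x' ∉ B ∧ x'ᶜ ∈ B) ∨ (x' ∈ B ∧ x' ∉ C ∧ x'ᶜ ∈ B ∧ x'ᶜ ∈ C)) → φ x = φ x' → x = x' := by
  classical
  -- `E = H_B ∪ (B ∩ C)` as a predicate; the down-sets `𝒜 = L ∖ B`, `𝒞 = L ∩ σC`
  let E : Finset α → Prop := fun x => x ∈ B ∧ (xᶜ ∉ B ∨ x ∈ C)
  have E_mono : ∀ {x x' : Finset α}, x ⊆ x' → E x → E x' := fun h hx =>
    ⟨hB _ hx.1 _ h, hx.2.imp (fun hn hc => hn (hB _ hc _ (compl_subset_compl.2 h))) (fun hc => hC _ hc _ h)⟩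
  let 𝒜 : Finset (Finset α) := univ.filter fun x => ¬ E x ∧ E xᶜ ∧ x ∉ B
  let 𝒞 : Finset (Finset α) := univ.filter fun x => ¬ E x ∧ E xᶜ ∧ xᶜ ∈ C
  have hm𝒜 : ∀ x, x ∈ 𝒜 ↔ ¬ E x ∧ E xᶜ ∧ x ∉ B := fun x => by simp only [𝒜, mem_filter, mem_univ, true_and]
  have hm𝒞 : ∀ x, x ∈ 𝒞 ↔ ¬ E x ∧ E xᶜ ∧ xᶜ ∈ C := fun x => by simp only [𝒞, mem_filter, mem_univ, true_and]
  have h𝒜 : ∀ K ∈ 𝒜, ∀ K' ⊆ K, K' ∈ 𝒜 := by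
    intro K hK K' hK'
    rw [hm𝒜] at hK ⊢
    exact ⟨fun h => hK.1 (E_mono hK' h), E_mono (compl_subset_compl.2 hK') hK.2.1, fun h => hK.2.2 (hB _ h _ hK')⟩
  have h𝒞 : ∀ K ∈ 𝒞, ∀ K' ⊆ K, K' ∈ 𝒞 := by
    intro K hK K' hK'
    rw [hm𝒞] at hK ⊢
    exact ⟨fun h => hK.1 (E_mono hK' h), E_mono (compl_subset_compl.2 hK') hK.2.1, hC _ hK.2.2 _ (compl_subset_compl.2 hK')⟩
  have hL : ∀ x : Finset α, x ∈ 𝒜 ∪ 𝒞 ↔ ¬ E x ∧ E xᶜ := by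
    intro x
    rw [mem_union, hm𝒜, hm𝒞]
    constructor
    · rintro (⟨h1, h2, -⟩ | ⟨h1, h2, -⟩) <;> exact ⟨h1, h2⟩
    · rintro ⟨h1, h2⟩
      by_cases hb : x ∈ B
      · refine Or.inr ⟨h1, h2, ?_⟩
        rcases h2.2 with hn | hc
        · rw [compl_compl] at hn; exact absurd hb hn
        · exact hc
      · exact Or.inl ⟨h1, h2, hb⟩
  obtain ⟨ψ, hψ⟩ := exists_disjoint_equiv_of_union h𝒜 h𝒞
  -- sources lie in `L`
  have src_mem : ∀ x : Finset α, ((x ∈ C ∧ x ∉ B ∧ xᶜ ∈ B) ∨ (x ∈ B ∧ x ∉ C ∧ xᶜ ∈ B ∧ xᶜ ∈ C)) → x ∈ 𝒜 ∪ 𝒞 := by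
    intro x h
    rw [hL]
    rcases h with ⟨hxC, hxB, hcB⟩ | ⟨hxB, hxC, hcB, hcC⟩
    · exact ⟨fun hE => hxB hE.1, ⟨hcB, Or.inl (by rw [compl_compl]; exact hxB)⟩⟩
    · exact ⟨fun hE => hE.2.elim (fun hn => hn hcB) hxC, ⟨hcB, Or.inr hcC⟩⟩
  let φ : Finset α → Finset α := fun x => if h : x ∈ 𝒜 ∪ 𝒞 then ((ψ ⟨x, h⟩ : ↥(𝒜 ∪ 𝒞)) : Finset α)ᶜ else x
  have key : ∀ (x : Finset α) (h : x ∈ 𝒜 ∪ 𝒞), x ⊆ φ x ∧ E (φ x) ∧ ¬ E (φ x)ᶜ ∧ (x ∈ B → (φ x) ∈ C) := by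
    intro x h
    have hφ : φ x = ((ψ ⟨x, h⟩ : ↥(𝒜 ∪ 𝒞)) : Finset α)ᶜ := by simp only [φ, dif_pos h]
    obtain ⟨hyE, hycoE⟩ := (hL _).1 (ψ ⟨x, h⟩).2
    rw [hφ, compl_compl]
    refine ⟨?_, hycoE, hyE, fun hxB => ?_⟩
    · rw [subset_compl_iff_disjoint_right]
      exact (hψ ⟨x, h⟩).1
    · have hxA : x ∉ 𝒜 := fun h' => ((hm𝒜 _).1 h').2.2 hxB
      exact ((hm𝒞 _).1 ((hψ ⟨x, h⟩).2.resolve_left hxA)).2.2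
  refine ⟨φ, fun x hx => ?_⟩
  have hxL := src_mem x hx
  obtain ⟨k1, k2, k3, k4⟩ := key x hxL
  refine ⟨k1, k2.1, ?_, fun hc => k3 ⟨hc.1, Or.inr hc.2⟩, fun x' hx' heq => ?_⟩
  · rcases hx with ⟨hxC, -, -⟩ | ⟨hxB, -, -, -⟩
    · exact hC _ hxC _ k1
    · exact k4 hxB
  · have hx'L := src_mem x' hx'
    have h1 : φ x = ((ψ ⟨x, hxL⟩ : ↥(𝒜 ∪ 𝒞)) : Finset α)ᶜ := by simp only [φ, dif_pos hxL]
    have h2 : φ x' = ((ψ ⟨x', hx'L⟩ : ↥(𝒜 ∪ 𝒞)) : Finset α)ᶜ := by simp only [φ, dif_pos hx'L]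
    rw [h1, h2, compl_inj_iff] at heq
    have h3 : (⟨x, hxL⟩ : ↥(𝒜 ∪ 𝒞)) = ⟨x', hx'L⟩ := ψ.injective (Subtype.ext heq)
    exact congrArg Subtype.val h3

/-- **Shared Kleitman–Hall, counting form on a cube** (CLAIM 2 of memo g27 = (C2); `Finset` version).  For up-closed families `B, C, U` of subsets of a
finite type: `#{x∈U : x∈C∖B, xᶜ∈B} + #{x∈U : x∈B∖C, xᶜ∈B∩C} ≤ #{x∈U : x∈B∩C, xᶜ∉B∩C}`. [this work] -/
theorem sharedKleitmanHall_card [LinearOrder α] (B C U : Finset (Finset α))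
    (hB : ∀ K ∈ B, ∀ K', K ⊆ K' → K' ∈ B) (hC : ∀ K ∈ C, ∀ K', K ⊆ K' → K' ∈ C) (hU : ∀ K ∈ U, ∀ K', K ⊆ K' → K' ∈ U) :
    #(U.filter fun x => x ∈ C ∧ x ∉ B ∧ xᶜ ∈ B) + #(U.filter fun x => x ∈ B ∧ x ∉ C ∧ xᶜ ∈ B ∧ xᶜ ∈ C) ≤
      #(U.filter fun x => x ∈ B ∧ x ∈ C ∧ ¬ (xᶜ ∈ B ∧ xᶜ ∈ C)) := by
  classical
  obtain ⟨φ, hφ⟩ := exists_sharedKleitmanHall_injection B C hB hC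
  rw [← card_union_of_disjoint (disjoint_filter.2 fun x _ h1 h2 => h2.2.1 h1.1)]
  refine card_le_card_of_injOn φ (fun x hx => ?_) (fun x₁ hx₁ x₂ hx₂ heq => ?_)
  · rw [coe_union, Set.mem_union, coe_filter, coe_filter, Set.mem_setOf_eq, Set.mem_setOf_eq] at hx
    have hxU : x ∈ U := by rcases hx with h | h <;> exact h.1
    have hsrc : (x ∈ C ∧ x ∉ B ∧ xᶜ ∈ B) ∨ (x ∈ B ∧ x ∉ C ∧ xᶜ ∈ B ∧ xᶜ ∈ C) := by
      rcases hx with h | h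
      · exact Or.inl h.2
      · exact Or.inr h.2
    obtain ⟨k1, k2, k3, k4, -⟩ := hφ x hsrc
    rw [mem_coe, mem_filter]
    exact ⟨hU _ hxU _ k1, k2, k3, k4⟩
  · rw [coe_union, Set.mem_union, coe_filter, coe_filter, Set.mem_setOf_eq, Set.mem_setOf_eq] at hx₁ hx₂
    have hs₁ : (x₁ ∈ C ∧ x₁ ∉ B ∧ x₁ᶜ ∈ B) ∨ (x₁ ∈ B ∧ x₁ ∉ C ∧ x₁ᶜ ∈ B ∧ x₁ᶜ ∈ C) := by
      rcases hx₁ with h | h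
      · exact Or.inl h.2
      · exact Or.inr h.2
    have hs₂ : (x₂ ∈ C ∧ x₂ ∉ B ∧ x₂ᶜ ∈ B) ∨ (x₂ ∈ B ∧ x₂ ∉ C ∧ x₂ᶜ ∈ B ∧ x₂ᶜ ∈ C) := by
      rcases hx₂ with h | h
      · exact Or.inl h.2
      · exact Or.inr h.2
    exact (hφ x₁ hs₁).2.2.2.2 x₂ hs₂ heq

end SahiFComb.Shift

end Summit.CriticalPhenomena.PercolationContinuityZ3.Theorems
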